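import Summits.BirchSwinnertonDyer.BirchSwinnertonDyer.Theses.RamifiedHeegnerPair
import Summits.BirchSwinnertonDyer.BirchSwinnertonDyer.Theorems.RamifiedHeegnerPairRamifiedPairLowerBoundOfLowerHalves
import Summits.BirchSwinnertonDyer.Rank1Residual.Additive.FouquetWanLocus
import Summits.BirchSwinnertonDyer.Rank1Residual.Additive.LocIrrOddPrimes
import HarnessLib

/-!
# Route `RamifiedHeegnerPair`, crux X1 `RamifiedPairLowerBound` (stmt-BirchSwinnertonDyer-23191), line `birth` v3 —
# stub L₀ (`stub_gssLowerAtThree_rankZero`) ON THE FOUQUET–WAN ROWS, from the cell's existing shells BY NAME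

HONEST FRAMING. Theorems only; helper file (`--supports stmt-BirchSwinnertonDyer-23191`), CONDITIONAL on every displayed
hypothesis; credits nothing toward closing the item; BSD is not proved by any of this. No new definition, no new named
fact, no restatement: the Fouquet–Wan CLAIM enters only as the cell's hypothesis SHAPE `FouquetWanClaimShape KMC`
(arXiv:2107.13726 Thm. 5.1 / 1.7 for `f = f_E`: `E[p]` irreducible, `E[p]|G_{ℚ_p}` irreducible, a non-split
multiplicative `q ≠ p` with `E[p]` ramified ⊢ Kato's main conjecture `KMC W p`; PRE, unrefereed), Kato's main conjecture
only as the interface `KMC`, and the additive descent only as the cell's conjecture shell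
`O5.PotSupersingularLowerHalfRankZeroOfKMC KMC` (Kato Conj. 12.10 + Prop. 14.16 (2) read as an equality on O5 ∪ O6 at `3`).

WHAT. The registered stub L₀ of skeleton v3 is the rank-`0` lower half `Typed.MissingLowerBoundAt W 3` on the non-CM Gss2
leaf (`Addv W 3 ∧ SubGss W 3`). A Gss2 curve is in class O5 (`ClassO5 W 3 := 3 ≠ 2 ∧ Addv W 3 ∧ (SubGss ∨ SubTprime)`,
left disjunct), is X4 (`classX4_of_subGss_of_ne_two`: `W[3] ≅ V₁[3] ⊗ χ₋₃` with `V₁` good supersingular, Serre 1972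
Prop. 12) and is LOCALLY irreducible at `3` (`locIrr_of_subGss_of_ne_two`: fundamental characters of level `2`), so of
Fouquet–Wan's three hypotheses only the Steinberg one is a genuine ROW condition on Gss2: `FWNonsplitRam W 3` (a prime
`q ≠ 3` of non-split multiplicative reduction with `3 ∤ v_q(Δ_min)`). Hence, by the cell's
`missingLowerBoundAt_three_of_fwClaim_of_shared` (`Additive/FouquetWanLocus.lean`):

* `gssLowerAtThree_rankZero_fwRows_of_fwClaim_of_shared` — L₀ on the Gss2 rows with `FWNonsplitRam W 3` and surjective
  `3`-adic tower (Kato's (12.5.2), `Kato2004.ImageContainsSL2 W 3`), from the claim shape + the shared shell + GZK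
  (finiteness of `Ш`) + modularity (`L(E,1) ≠ 0 ⇔ r_an = 0`);
* `gssLowerAtThree_rankZero_of_offRows_of_fwClaim_of_shared` — L₀ itself (the registered stub's statement VERBATIM as the
  conclusion) from the same inputs AND L₀ on the complementary rows (no non-split ramified Steinberg prime, or `3`-adic
  tower not onto) — excluded middle; the complementary rows are the stub's open residue with nothing announced;
* `ramifiedPairLowerBound_of_fwClaim_of_shared_of_offRows_of_rankOne` — X1 BY NAME from: `PublishedInputGZK`,
  `GoodSupersingularAtThree` (the route's own items), modularity, the claim shape, the shared shell, L₀ off the FW rows,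
  and L₁ (the load-bearing stub `stub_gssLowerAtThree_rankOne`, verbatim) — via p606339's
  `ramifiedPairLowerBound_of_gssLowerHalves_of_items`.

Census reading (instrument only; `Cruxes/RamifiedPairLowerBound/LOWER-HALVES-CORE.md` §3, N < 5·10⁵): of the 366 INTRINSIC rank-`0`
Gss2 classes (every member `3 ∣ #Ш_an`; the others are free by Cassels transport, p606339 §3) 273 have `FWNonsplitRam` (all with
`ρ̄₃` onto; tower-onto mod 9 not checked) and 93 do not.

References: O. Fouquet, X. Wan, arXiv:2107.13726 Thm. 1.7 (p. 5), Thm. 5.1 (p. 53) (claim shape only); K. Kato, Astérisque 295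
(2004) Conj. 12.10 (p. 224), (12.5.2) (p. 222), Prop. 14.16 (2) (p. 244); J.-P. Serre, Invent. Math. 15 (1972) §1.11 Prop. 12;
R. L. Miller, LMS J. Comput. Math. 14 (2011) Def. 1.1; H. Darmon, *Rational points on modular elliptic curves* (2004) Thm. 3.22.
-/

-- D-0017: single-problem summit, so `Summit.BirchSwinnertonDyer.BirchSwinnertonDyer.…` repeats a namespace BY DESIGN.
set_option linter.dupNamespace false
set_option autoImplicit false

noncomputable section

open scoped Classical

open WeierstrassCurve Literature.NumberTheory.EllipticCurves Literature.NumberTheory.EllipticCurves.ModularForms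
  Literature.NumberTheory.EllipticCurves.Rank1Residual Literature.NumberTheory.EllipticCurves.Rank1Residual.Typed
  Summit.BirchSwinnertonDyer.Rank1Residual.Additive Summit.BirchSwinnertonDyer.Rank1Residual
  Summit.BirchSwinnertonDyer.BirchSwinnertonDyer.Theses.RamifiedHeegnerPair

namespace Summit.BirchSwinnertonDyer.BirchSwinnertonDyer.Theorems.RamifiedPairLowerBound

variable (KMC : ∀ (W : WeierstrassCurve ℚ) [W.IsElliptic] [W.IsGloballyMinimal] (p : ℕ), Prop)

/-- **L₀ on the Fouquet–Wan rows of the Gss2 leaf.** For a non-CM globally minimal `W` additive of class Gss2 at `3` with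
`ord_{s=1} L(W,s) = 0`, a prime `q ≠ 3` of NON-SPLIT multiplicative reduction with `3 ∤ v_q(Δ_min)` (`FWNonsplitRam W 3`)
and surjective `3`-adic tower (`Kato2004.ImageContainsSL2 W 3`): the claim shape `hFW` (PRE), the shared additive-descent
shell `hshared`, GZK `hGZK` (finiteness of `Ш`) and modularity `hmod` (`L(W,1) ≠ 0`) give `Typed.MissingLowerBoundAt W 3`.
The X4 and local-irreducibility antecedents of the claim are THEOREMS on Gss2 (`classX4_of_subGss_of_ne_two`,
`locIrr_of_subGss_of_ne_two`). CONDITIONAL; credits nothing. [cite: FouquetWan2021, Thm. 5.1 (p. 53) and Thm. 1.7 (p. 5)]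
[cite: Kato2004Asterisque, Conj. 12.10 (p. 224), Prop. 14.16 (2) (p. 244)] [cite: Serre1972, §1.11 Prop. 12] -/
theorem gssLowerAtThree_rankZero_fwRows_of_fwClaim_of_shared (hFW : FouquetWanClaimShape KMC)
    (hshared : O5.PotSupersingularLowerHalfRankZeroOfKMC KMC) (hGZK : rank_eq_analyticRank_of_analyticRank_le_one)
    (hmod : hasEntireLFunction_rat) :
    ∀ (W : WeierstrassCurve ℚ) [W.IsElliptic] [W.IsGloballyMinimal],
      ¬ W.HasCM → Addv W 3 → SubGss W 3 → W.analyticRank = 0 →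
      FWNonsplitRam W 3 → Kato2004.ImageContainsSL2 W 3 → MissingLowerBoundAt W 3 := by
  intro W _ _ _hCM hadd hG hr hstb himg
  haveI : Fact (Nat.Prime 3) := ⟨Nat.prime_three⟩
  have h32 : (3 : ℕ) ≠ 2 := by decide
  have hO5 : ClassO5 W 3 := ⟨h32, hadd, Or.inl hG⟩
  have hX : ClassX4 W 3 := classX4_of_subGss_of_ne_two W 3 h32 hadd hG
  have hirr : LocIrr W 3 := locIrr_of_subGss_of_ne_two W 3 h32 hadd hG
  have hL : W.entireLFunction 1 ≠ 0 := (W.analyticRank_eq_zero_iff_holds (hmod W)).mp hr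
  have hfin : Finite W.sha := (hGZK W (hr.le.trans zero_le_one)).2
  exact missingLowerBoundAt_three_of_fwClaim_of_shared KMC hFW hshared W (Or.inl hO5) hX hirr hstb himg hL hfin

/-- **Stub L₀ VERBATIM from the FW inputs and its off-row residue** (excluded middle on
`FWNonsplitRam W 3 ∧ Kato2004.ImageContainsSL2 W 3`): the registered statement `Sig.stub_gssLowerAtThree_rankZero` of
skeleton v3 follows from the claim shape, the shared shell, GZK, modularity AND the lower half on the Gss2 rank-`0` rows
WITHOUT a non-split ramified Steinberg prime or WITHOUT surjective `3`-adic tower (`hoff` — the stub's genuinely open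
residue: Kato's Conj. 12.10 at an additive `3` with nothing announced; 93 of the 366 intrinsic classes of record).
CONDITIONAL; the stub is NOT landed by name. [cite: FouquetWan2021, Thm. 5.1 (p. 53)]
[cite: Kato2004Asterisque, Conj. 12.10 (p. 224)] -/
theorem gssLowerAtThree_rankZero_of_offRows_of_fwClaim_of_shared (hFW : FouquetWanClaimShape KMC)
    (hshared : O5.PotSupersingularLowerHalfRankZeroOfKMC KMC) (hGZK : rank_eq_analyticRank_of_analyticRank_le_one)
    (hmod : hasEntireLFunction_rat)
    (hoff : ∀ (W : WeierstrassCurve ℚ) [W.IsElliptic] [W.IsGloballyMinimal],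
      ¬ W.HasCM → Addv W 3 → SubGss W 3 → W.analyticRank = 0 →
      ¬ (FWNonsplitRam W 3 ∧ Kato2004.ImageContainsSL2 W 3) → MissingLowerBoundAt W 3) :
    ∀ (W : WeierstrassCurve ℚ) [W.IsElliptic] [W.IsGloballyMinimal],
      ¬ W.HasCM → Addv W 3 → SubGss W 3 → W.analyticRank = 0 → MissingLowerBoundAt W 3 := by
  intro W _ _ hCM hadd hG hr
  by_cases hrow : FWNonsplitRam W 3 ∧ Kato2004.ImageContainsSL2 W 3
  · exact gssLowerAtThree_rankZero_fwRows_of_fwClaim_of_shared KMC hFW hshared hGZK hmod W hCM hadd hG hr hrow.1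
      hrow.2
  · exact hoff W hCM hadd hG hr hrow

/-- **X1 BY NAME with L₀ cut along the Fouquet–Wan rows.** GIVEN the route's items `PublishedInputGZK` (`hP`) and
`GoodSupersingularAtThree` (`hR`, the declared residual), modularity `hmod`, the claim shape `hFW` (PRE), the shared
shell `hshared`, the rank-`0` lower half OFF the FW rows (`hoff`) and the rank-`1` lower half on the whole Gss2 leaf
(`h1` = the load-bearing stub `Sig.stub_gssLowerAtThree_rankOne` verbatim), the crux holds — p606339's
`ramifiedPairLowerBound_of_gssLowerHalves_of_items`. CONDITIONAL; credits nothing; the item stays open (its content is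
`hoff ∧ h1`, plus the refereeing of FW and the shells). [cite: FouquetWan2021, Thm. 5.1 (p. 53)]
[cite: Kato2004Asterisque, Conj. 12.10 (p. 224)] [cite: Miller2011LMS, §1 and Def. 1.1] [cite: Darmon2004, Thm. 3.22] -/
theorem ramifiedPairLowerBound_of_fwClaim_of_shared_of_offRows_of_rankOne (hP : PublishedInputGZK)
    (hR : GoodSupersingularAtThree) (hmod : hasEntireLFunction_rat) (hFW : FouquetWanClaimShape KMC)
    (hshared : O5.PotSupersingularLowerHalfRankZeroOfKMC KMC)
    (hoff : ∀ (W : WeierstrassCurve ℚ) [W.IsElliptic] [W.IsGloballyMinimal],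
      ¬ W.HasCM → Addv W 3 → SubGss W 3 → W.analyticRank = 0 →
      ¬ (FWNonsplitRam W 3 ∧ Kato2004.ImageContainsSL2 W 3) → MissingLowerBoundAt W 3)
    (h1 : ∀ (W : WeierstrassCurve ℚ) [W.IsElliptic] [W.IsGloballyMinimal],
      ¬ W.HasCM → Addv W 3 → SubGss W 3 → W.analyticRank = 1 → MissingLowerBoundAt W 3) :
    RamifiedPairLowerBound :=
  ramifiedPairLowerBound_of_gssLowerHalves_of_items hP hR
    (gssLowerAtThree_rankZero_of_offRows_of_fwClaim_of_shared KMC hFW hshared hP hmod hoff) h1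

end Summit.BirchSwinnertonDyer.BirchSwinnertonDyer.Theorems.RamifiedPairLowerBound

end
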